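import Summits.Ventures.CertifiedManyBodySolver.Observables.SourcedOrderParameterFloorTTPrime
import Summits.Ventures.CertifiedManyBodySolver.Observables.TIGrandCanonicalChordFloor
import Literature.MathematicalPhysics.QuantumLattice.DWaveSourceEnergyDensityEnsembles
import Literature.MathematicalPhysics.QuantumLattice.DWaveSourceNNNHoppingEnergyDensityExists
import HarnessLib

/-!
# The torus STAIR `liminf_L m_{L+1}(h)` of the `t–t′` pinning-field response, bracketed by the
# thermodynamic-limit sourced energy density `e_src` — unconditional, and fed by `μ`-floors / canonical rows

HONEST FRAMING: finite-field RESPONSE floors/ceilings (certified once the input rows are); never an order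
parameter, never a phase word; not a superconductivity verdict; every number certified or labelled float.

Venture `CertifiedManyBodySolver`, cell `hubbard-cq` (rung CQ, CQ-TABLE §B1), seat `hubbard-cq-obsth-3` (row
«Hellmann–Feynman bracket → m_d(h) two-sided node»). The stair nodes of `SourcedOrderParameterFloorTTPrime.lean` §3
(`le_liminf_dWaveSourceDensityTT'_of_tendsto`, `limsup_dWaveSourceDensityTT'_le_of_tendsto`) took the convergence
`E₀(A_{L+1}(h))/(L+1)² → g(h)` as a hypothesis; since `DWaveSourceNNNHoppingEnergyDensityExists.lean` (hubbard-cq-obsth-2,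
`tendsto_dWaveSourceEnergyDensityTT'`) that limit EXISTS for all real `t′, U, μ, h` and is the def
`e_src = dWaveSourceEnergyDensityTT' t′ U μ h`, and since `DWaveSourceEnergyDensityEnsembles.lean` identifies
`e_src(t′,U,μ,0) = gcEnergyDensityTT' 1 t′ U μ` (`U ≥ 0`). This file writes the UNCONDITIONAL stair brackets and
their fed forms:

* §1 `slope_energyDensity_le_liminf_dWaveSourceDensityTT'` / `limsup_dWaveSourceDensityTT'_le_slope_energyDensity` /
  `liminf_limsup_dWaveSourceDensityTT'_mem_energyDensity`: for `h₁ < h < h₂`,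
  `(e_src(h₁) − e_src(h))/(2(h − h₁)) ≤ liminf_L m_{L+1}(h) ≤ limsup_L m_{L+1}(h) ≤ (e_src(h) − e_src(h₂))/(2(h₂ − h))`
  (no slack, no hypothesis; `m_L(h) = dWaveSourceDensityTT' L t′ U μ h`).
* §2 FLOOR fed by a grand-canonical `μ`-FLOOR (TL sentence `c ≤ gcEnergyDensityTT' 1 t′ U μ`, the shape of the box
  programme's `μ`-floors / of a GC reading of a canonical certificate) and a TL sourced CAP `e_src(h) ≤ u`:
  `(c − u)/(2h) ≤ liminf_L m_{L+1}(h)` (`le_liminf_dWaveSourceDensityTT'_of_gcFloor_of_energyDensity_le`); cap from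
  eventual finite-torus caps (`…_of_gcFloor_of_forall_groundEnergy_le`); TANGENT form with a mean-density cap — the
  `μ`-terms cancel (`le_liminf_dWaveSourceDensityTT'_of_tangent_of_meanDensityCap`); the `(0, 8)` instance at
  `μ₄₇₃ = 980464777135/2³⁹` with the `μ`-floor as hypothesis (`le_liminf_dWaveSourceDensity_anchor473_of_gcFloor`).
* §4 (appended) THE THIRD PREMISE ROUTE: certified finite-torus GC floors at `h = 0` (pilot job D's `G_μ` rows,
  `lo·L² ≤ E₀(A_L(μ,0))` for `L ≥ L₀`) ARE `μ`-floors (`gcFloor_of_forall_groundEnergy_dWaveSourceTorusTT'_zero_ge`, via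
  `e_src(μ,0) = p(μ)`), so both the stair floor (`le_liminf_dWaveSourceDensityTT'_of_gcRows`) and the GC-class TI floor
  (`re_expect_localPairAt_ge_of_gcRows_of_sourced_le`) are fed by rows end to end.
* §3 CEILING fed by today's table: a canonical upper row `e(1,t′,U,n) ≤ R` (any `n ∈ [0,2)`) and a TL sourced floor
  `lo ≤ e_src(h₂)` at `h₂ > h` give `limsup_L m_{L+1}(h) ≤ (R − μn − lo)/(2(h₂ − h))`
  (`limsup_dWaveSourceDensityTT'_le_of_canonical_upper_of_energyDensity_ge`).

No definition, no named fact, no `sorry`; zero compute.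

References: T. Koma, H. Tasaki, J. Stat. Phys. 76 (1994) 745, §1 [cite: KomaTasaki1994, §1]; R. B. Griffiths,
Phys. Rev. 152 (1966) 240, §II [cite: Griffiths1966, §II]; D. Ruelle, *Statistical Mechanics* (1969) §3.4
[cite: Ruelle1969, §3.4].
-/

noncomputable section

namespace Summit.Ventures.CertifiedManyBodySolver.Observables

open Literature.MathematicalPhysics.QuantumLattice Literature.Probability.LatticeModels
open ThermodynamicLimit Filter Topology

/-! ### §1 Unconditional stair brackets from `e_src` -/

section Unconditional

variable (t' U μ : ℝ)

/-- **Stair FLOOR from the TL sourced energy density (unconditional)**: for `h₁ < h`,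
`(e_src(h₁) − e_src(h))/(2(h − h₁)) ≤ liminf_L dWaveSourceDensityTT' (L+1) t′ U μ h`. [cite: KomaTasaki1994, §1] -/
theorem slope_energyDensity_le_liminf_dWaveSourceDensityTT' {h₁ h : ℝ} (hlt : h₁ < h) :
    (dWaveSourceEnergyDensityTT' t' U μ h₁ - dWaveSourceEnergyDensityTT' t' U μ h) / (2 * (h - h₁)) ≤
      liminf (fun L : ℕ => dWaveSourceDensityTT' (L + 1) t' U μ h) atTop :=
  le_liminf_dWaveSourceDensityTT'_of_tendsto t' U μ hlt (tendsto_dWaveSourceEnergyDensityTT' t' U μ h₁)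
    (tendsto_dWaveSourceEnergyDensityTT' t' U μ h)

/-- **Stair CEILING from the TL sourced energy density (unconditional)**: for `h < h₂`,
`limsup_L dWaveSourceDensityTT' (L+1) t′ U μ h ≤ (e_src(h) − e_src(h₂))/(2(h₂ − h))`. [cite: KomaTasaki1994, §1] -/
theorem limsup_dWaveSourceDensityTT'_le_slope_energyDensity {h h₂ : ℝ} (hlt : h < h₂) :
    limsup (fun L : ℕ => dWaveSourceDensityTT' (L + 1) t' U μ h) atTop ≤
      (dWaveSourceEnergyDensityTT' t' U μ h - dWaveSourceEnergyDensityTT' t' U μ h₂) / (2 * (h₂ - h)) :=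
  limsup_dWaveSourceDensityTT'_le_of_tendsto t' U μ hlt (tendsto_dWaveSourceEnergyDensityTT' t' U μ h)
    (tendsto_dWaveSourceEnergyDensityTT' t' U μ h₂)

/-- **Two-sided stair bracket (unconditional)**: for `h₁ < h < h₂`,
`(e_src(h₁) − e_src(h))/(2(h − h₁)) ≤ liminf_L m_{L+1}(h) ≤ limsup_L m_{L+1}(h) ≤ (e_src(h) − e_src(h₂))/(2(h₂ − h))`.
[cite: KomaTasaki1994, §1] -/
theorem liminf_limsup_dWaveSourceDensityTT'_mem_energyDensity {h₁ h h₂ : ℝ} (hlo : h₁ < h) (hhi : h < h₂) :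
    (dWaveSourceEnergyDensityTT' t' U μ h₁ - dWaveSourceEnergyDensityTT' t' U μ h) / (2 * (h - h₁)) ≤
        liminf (fun L : ℕ => dWaveSourceDensityTT' (L + 1) t' U μ h) atTop ∧
      liminf (fun L : ℕ => dWaveSourceDensityTT' (L + 1) t' U μ h) atTop ≤
        limsup (fun L : ℕ => dWaveSourceDensityTT' (L + 1) t' U μ h) atTop ∧
      limsup (fun L : ℕ => dWaveSourceDensityTT' (L + 1) t' U μ h) atTop ≤
        (dWaveSourceEnergyDensityTT' t' U μ h - dWaveSourceEnergyDensityTT' t' U μ h₂) / (2 * (h₂ - h)) :=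
  ⟨slope_energyDensity_le_liminf_dWaveSourceDensityTT' t' U μ hlo, liminf_le_limsup_dWaveSourceDensityTT' t' U μ h,
    limsup_dWaveSourceDensityTT'_le_slope_energyDensity t' U μ hhi⟩

end Unconditional

/-! ### §2 Stair FLOORS fed by a grand-canonical `μ`-floor -/

section GCFloor

variable (t' : ℝ) {U : ℝ}

/-- **Stair floor from a `μ`-FLOOR and a TL sourced cap.** For `U ≥ 0`, `h > 0`: a grand-canonical source-free floor
`c ≤ p(1,t′,U,μ) = e_src(t′,U,μ,0)` and a cap `e_src(t′,U,μ,h) ≤ u` give `(c − u)/(2h) ≤ liminf_L m_{L+1}(μ; h)`.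
[cite: KomaTasaki1994, §1] [cite: Ruelle1969, §3.4] -/
theorem le_liminf_dWaveSourceDensityTT'_of_gcFloor_of_energyDensity_le (hU : 0 ≤ U) (μ : ℝ) {h c u : ℝ}
    (hh : 0 < h) (hc : c ≤ gcEnergyDensityTT' 1 t' U μ) (hu : dWaveSourceEnergyDensityTT' t' U μ h ≤ u) :
    (c - u) / (2 * h) ≤ liminf (fun L : ℕ => dWaveSourceDensityTT' (L + 1) t' U μ h) atTop := by
  have key := slope_energyDensity_le_liminf_dWaveSourceDensityTT' t' U μ hh
  rw [sub_zero, dWaveSourceEnergyDensityTT'_zero_eq_gcEnergyDensityTT' t' hU μ] at key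
  refine le_trans ?_ key
  exact div_le_div_of_nonneg_right (by linarith) (by positivity)

/-- **… with the cap from eventual finite-torus caps** (`E₀(A_L(h)) ≤ u·L²` for all `L ≥ L₀`, the row shape
`SourcedEnergyUpperRow … 1 L₀ u`). [cite: KomaTasaki1994, §1] -/
theorem le_liminf_dWaveSourceDensityTT'_of_gcFloor_of_forall_groundEnergy_le (hU : 0 ≤ U) (μ : ℝ) {h c u : ℝ}
    (hh : 0 < h) (hc : c ≤ gcEnergyDensityTT' 1 t' U μ) {L₀ : ℕ}
    (hcap : ∀ (L : ℕ) [NeZero L], L₀ ≤ L → (dWaveSourceTorusTT' L t' U μ h).groundEnergy ≤ u * (L : ℝ) ^ 2) :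
    (c - u) / (2 * h) ≤ liminf (fun L : ℕ => dWaveSourceDensityTT' (L + 1) t' U μ h) atTop :=
  le_liminf_dWaveSourceDensityTT'_of_gcFloor_of_energyDensity_le t' hU μ hh hc
    (dWaveSourceEnergyDensityTT'_le_of_forall_le t' U μ h hcap)

/-- **TANGENT form, the `μ`-terms cancel.** For `U ≥ 0`, `h > 0`: the all-densities tangent
`ℓ + μ(m − n) ≤ e(1,t′,U,m)` (`m ∈ (0,2)`; what a density-`n` certificate with filling multiplier `μ` proves) and a
MEAN-DENSITY cap `e_src(t′,U,μ,h) ≤ u₀ − μ·n` (a trial state of density `n` with `μ = 0`-pencil sourced energy `≤ u₀`,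
read at `μ`) give `(ℓ − u₀)/(2h) ≤ liminf_L m_{L+1}(μ; h)`. [cite: KomaTasaki1994, §1] [cite: Ruelle1969, §3.4] -/
theorem le_liminf_dWaveSourceDensityTT'_of_tangent_of_meanDensityCap (hU : 0 ≤ U) (μ : ℝ) {h ℓ u₀ n : ℝ}
    (hh : 0 < h) (htan : ∀ m : ℝ, 0 < m → m < 2 → ℓ + μ * (m - n) ≤ energyDensityTT' 1 t' U m)
    (hu : dWaveSourceEnergyDensityTT' t' U μ h ≤ u₀ - μ * n) :
    (ℓ - u₀) / (2 * h) ≤ liminf (fun L : ℕ => dWaveSourceDensityTT' (L + 1) t' U μ h) atTop := by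
  have key := le_liminf_dWaveSourceDensityTT'_of_gcFloor_of_energyDensity_le t' hU μ hh
    (gcFloor_of_tangent (t' := t') hU htan) hu
  rwa [show ℓ - μ * n - (u₀ - μ * n) = ℓ - u₀ by ring] at key

/-- **The `(t′, U) = (0, 8)` stair floor at `μ₄₇₃ = 980464777135/2³⁹`** (CQ-TABLE §B1-U, GC class, stair object): the
`μ`-floor `hμ : ℓ₄₇₃ − (7/8)μ₄₇₃ ≤ gcEnergyDensityTT' 1 0 8 μ₄₇₃` (a HYPOTHESIS — the grand-canonical reading of #473's
dual, NOT the landed one-density node) and a TL sourced cap `e_src(0,8,μ₄₇₃,h) ≤ u` give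
`((ℓ₄₇₃ − (7/8)μ₄₇₃) − u)/(2h) ≤ liminf_L dWaveSourceDensity (L+1) 8 μ₄₇₃ h`; with `u = u₀ − (7/8)μ₄₇₃` (mean-density-`7/8`
cap) this is `(ℓ₄₇₃ − u₀)/(2h)`. A RESPONSE floor at one `μ`; nothing at `h → 0`. [cite: KomaTasaki1994, §1] -/
theorem le_liminf_dWaveSourceDensity_anchor473_of_gcFloor {h u : ℝ} (hh : 0 < h)
    (hμ : (((-1012151804787154021296135 / 1208925819614629174706176 : ℚ) -
        7 / 8 * (980464777135 / 549755813888 : ℚ) : ℚ) : ℝ) ≤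
      gcEnergyDensityTT' 1 0 8 ((980464777135 / 549755813888 : ℚ) : ℝ))
    (hu : dWaveSourceEnergyDensityTT' 0 8 ((980464777135 / 549755813888 : ℚ) : ℝ) h ≤ u) :
    ((((-1012151804787154021296135 / 1208925819614629174706176 : ℚ) -
        7 / 8 * (980464777135 / 549755813888 : ℚ) : ℚ) : ℝ) - u) / (2 * h) ≤
      liminf (fun L : ℕ => dWaveSourceDensity (L + 1) 8 ((980464777135 / 549755813888 : ℚ) : ℝ) h) atTop := by
  have key := le_liminf_dWaveSourceDensityTT'_of_gcFloor_of_energyDensity_le 0 (by norm_num : (0 : ℝ) ≤ 8)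
    ((980464777135 / 549755813888 : ℚ) : ℝ) hh hμ hu
  simpa only [dWaveSourceDensityTT'_zero] using key

end GCFloor

/-! ### §3 Stair CEILINGS fed by today's table -/

section Ceiling

variable (t' : ℝ) {U : ℝ}

/-- **Stair ceiling from a canonical UPPER row and a TL sourced FLOOR at a larger field.** For `U ≥ 0`, a density
`n ∈ [0,2)` with `e(1,t′,U,n) ≤ R` (any canonical upper), any `μ`, and `lo ≤ e_src(t′,U,μ,h₂)` at `h₂ > h`:
`limsup_L m_{L+1}(μ; h) ≤ (R − μn − lo)/(2(h₂ − h))` (cap at `h`: `e_src(h) ≤ e_src(0) ≤ R − μn`).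
[cite: KomaTasaki1994, §1] [cite: Ruelle1969, §3.4] -/
theorem limsup_dWaveSourceDensityTT'_le_of_canonical_upper_of_energyDensity_ge (hU : 0 ≤ U) (μ : ℝ) {n R : ℝ}
    (hn0 : 0 ≤ n) (hn2 : n < 2) (hR : energyDensityTT' 1 t' U n ≤ R) {h h₂ lo : ℝ} (hlt : h < h₂)
    (hlo : lo ≤ dWaveSourceEnergyDensityTT' t' U μ h₂) :
    limsup (fun L : ℕ => dWaveSourceDensityTT' (L + 1) t' U μ h) atTop ≤ (R - μ * n - lo) / (2 * (h₂ - h)) := by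
  have hcap := dWaveSourceEnergyDensityTT'_le_of_energyDensityTT'_le t' hU μ h hn0 hn2 hR
  refine (limsup_dWaveSourceDensityTT'_le_slope_energyDensity t' U μ hlt).trans ?_
  exact div_le_div_of_nonneg_right (by linarith) (by linarith)

/-- **… with the sourced floor from eventual finite-torus floors** (`lo·L² ≤ E₀(A_L(h₂))` for all `L ≥ L₀`).
[cite: KomaTasaki1994, §1] -/
theorem limsup_dWaveSourceDensityTT'_le_of_canonical_upper_of_forall_groundEnergy_ge (hU : 0 ≤ U) (μ : ℝ)
    {n R : ℝ} (hn0 : 0 ≤ n) (hn2 : n < 2) (hR : energyDensityTT' 1 t' U n ≤ R) {h h₂ lo : ℝ} (hlt : h < h₂)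
    {L₀ : ℕ} (hcut : ∀ (L : ℕ) [NeZero L], L₀ ≤ L → lo * (L : ℝ) ^ 2 ≤ (dWaveSourceTorusTT' L t' U μ h₂).groundEnergy) :
    limsup (fun L : ℕ => dWaveSourceDensityTT' (L + 1) t' U μ h) atTop ≤ (R - μ * n - lo) / (2 * (h₂ - h)) :=
  limsup_dWaveSourceDensityTT'_le_of_canonical_upper_of_energyDensity_ge t' hU μ hn0 hn2 hR hlt
    (dWaveSourceEnergyDensityTT'_ge_of_forall_le t' U μ h₂ hcut)

end Ceiling

/-! ### §4 (appended) The THIRD premise route: a certified finite-torus GC floor at `h = 0` IS the `μ`-floor -/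

section GCRows

variable (t' : ℝ) {U : ℝ}

/-- **A certified grand-canonical torus floor at `h = 0` is a `μ`-floor.** For `U ≥ 0`: rows
`lo·L² ≤ E₀(dWaveSourceTorusTT' L t′ U μ 0)` for every side `L ≥ L₀` (a premise-free sourced-menu floor at field
`0` and chemical potential `μ`, e.g. pilot job D's `G_μ`) give the TL sentence `lo ≤ gcEnergyDensityTT' 1 t′ U μ`
(`e_src(t′,U,μ,0) = p(1,t′,U,μ)`, `dWaveSourceEnergyDensityTT'_zero_eq_gcEnergyDensityTT'`) — the premise shape of
the grand-canonical chord floors (`TIGrandCanonicalChordFloor.lean` §1, this file §2). [cite: Ruelle1969, §3.4] -/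
theorem gcFloor_of_forall_groundEnergy_dWaveSourceTorusTT'_zero_ge (hU : 0 ≤ U) (μ : ℝ) {lo : ℝ} {L₀ : ℕ}
    (hlo : ∀ (L : ℕ) [NeZero L], L₀ ≤ L → lo * (L : ℝ) ^ 2 ≤ (dWaveSourceTorusTT' L t' U μ 0).groundEnergy) :
    lo ≤ gcEnergyDensityTT' 1 t' U μ := by
  rw [← dWaveSourceEnergyDensityTT'_zero_eq_gcEnergyDensityTT' t' hU μ]
  exact dWaveSourceEnergyDensityTT'_ge_of_forall_le t' U μ 0 hlo

/-- The same from EVENTUALLY-all sides along `L + 1` (`∀ᶠ L, lo·(L+1)² ≤ E₀(A_{L+1}(μ,0))`). [cite: Ruelle1969, §3.4] -/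
theorem gcFloor_of_eventually_groundEnergy_dWaveSourceTorusTT'_zero_ge (hU : 0 ≤ U) (μ : ℝ) {lo : ℝ}
    (hlo : ∀ᶠ L : ℕ in atTop, lo * (((L + 1 : ℕ) : ℝ)) ^ 2 ≤ (dWaveSourceTorusTT' (L + 1) t' U μ 0).groundEnergy) :
    lo ≤ gcEnergyDensityTT' 1 t' U μ := by
  rw [← dWaveSourceEnergyDensityTT'_zero_eq_gcEnergyDensityTT' t' hU μ]
  exact dWaveSourceEnergyDensityTT'_ge_of_eventually_le t' U μ 0 hlo

/-- **Stair floor, fully ROW-fed (the third route end to end).** For `U ≥ 0`, `h > 0`: a certified `h = 0` GC torus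
floor `lo·L² ≤ E₀(A_L(μ,0))` (`L ≥ L₀`) and a certified sourced torus cap `E₀(A_L(μ,h)) ≤ u·L²` (`L ≥ L₁`) give
`(lo − u)/(2h) ≤ liminf_L m_{L+1}(μ; h)` — via the TL objects (same number as the finite-window stair node
`le_liminf_dWaveSourceDensityTT'_of_window`, recorded here so that CQ-TABLE's three premise routes cite one file).
[cite: KomaTasaki1994, §1] -/
theorem le_liminf_dWaveSourceDensityTT'_of_gcRows (hU : 0 ≤ U) (μ : ℝ) {h lo u : ℝ} (hh : 0 < h) {L₀ L₁ : ℕ}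
    (hlo : ∀ (L : ℕ) [NeZero L], L₀ ≤ L → lo * (L : ℝ) ^ 2 ≤ (dWaveSourceTorusTT' L t' U μ 0).groundEnergy)
    (hcap : ∀ (L : ℕ) [NeZero L], L₁ ≤ L → (dWaveSourceTorusTT' L t' U μ h).groundEnergy ≤ u * (L : ℝ) ^ 2) :
    (lo - u) / (2 * h) ≤ liminf (fun L : ℕ => dWaveSourceDensityTT' (L + 1) t' U μ h) atTop :=
  le_liminf_dWaveSourceDensityTT'_of_gcFloor_of_forall_groundEnergy_le t' hU μ hh
    (gcFloor_of_forall_groundEnergy_dWaveSourceTorusTT'_zero_ge t' hU μ hlo) hcap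

/-- **Every translation-invariant state of the GC class, fully ROW-fed at `h = 0`** (the infinite-volume twin): a
certified `h = 0` GC torus floor `lo·L² ≤ E₀(A_L(μ,0))` and a translation-invariant `ω` with density in `(0,2)` whose own
sourced energy at `(μ, h)` is `≤ u` give `(lo − u)/(2h) ≤ Re ω(P₀^d)` (`TIGrandCanonicalChordFloor` §1 with the
`μ`-floor supplied by the rows). [cite: KomaTasaki1994, §1] [cite: Ruelle1969, §3.4] -/
theorem re_expect_localPairAt_ge_of_gcRows_of_sourced_le (hU : 0 ≤ U) (μ : ℝ) {h lo u : ℝ} (hh : 0 < h) {L₀ : ℕ}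
    (hlo : ∀ (L : ℕ) [NeZero L], L₀ ≤ L → lo * (L : ℝ) ^ 2 ≤ (dWaveSourceTorusTT' L t' U μ 0).groundEnergy)
    {ω : InfVolFermionState 2} (hω : ω.IsTranslationInvariant) (hρ0 : 0 < ω.density) (hρ2 : ω.density < 2)
    (hu : ω.meanEnergy (hubbardTTPrimeSourcedInteraction 1 t' U μ dWaveFormFactor h) 1 ≤ u) :
    (lo - u) / (2 * h) ≤
      (ω.expect (pairRegion (insert 0 unitSteps) 0) (localPairAt (insert 0 unitSteps) dWaveFormFactor 0)).re :=
  re_expect_localPairAt_ge_of_gcFloor_of_sourced_le hω hU hρ0 hρ2 hh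
    (gcFloor_of_forall_groundEnergy_dWaveSourceTorusTT'_zero_ge t' hU μ hlo) hu

end GCRows

end Summit.Ventures.CertifiedManyBodySolver.Observables

end
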